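import Summits.BirchSwinnertonDyer.BirchSwinnertonDyer.Theorems.UniversalToricDescentQuadraticBaseChangeAdicImage
import Summits.BirchSwinnertonDyer.Rank1Residual.PerrinRiouHeegnerPointMainConjecture
import HarnessLib

/-!
# The full-image-over-`K` binder of the Heegner-point main-conjecture files, DISCHARGED from (sur) over `ℚ`
# (every odd `p`; at `p = 3` for `9 ∤ N`)

Route `UniversalToricDescent` (BirchSwinnertonDyer), `--supports` stmt-BirchSwinnertonDyer-23594; namespace
`Summit.BirchSwinnertonDyer.BirchSwinnertonDyer.Theorems.AdicImageOverK`. THEOREMS ONLY. Consumers'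
glue for `UniversalToricDescentQuadraticBaseChangeAdicImage` (odd `p ≥ 5`, Serre) and
`UniversalToricDescentTwinFullThreeAdicImageOverK` (`p = 3`, Wuthrich): the hypothesis «every
`ℤ_p`-automorphism of `T_p(E_K)` is a Galois element» (= Howard 2004 Thm. B's image hypothesis =
Yan–Zhu 2026 Thm. 5.7's «`ρ_E(G_K) = Aut_{ℤ_p}(T_pE)`» = `HowardHypotheses.surjective`) of

* `Summit.BirchSwinnertonDyer.Rank1Residual.PerrinRiouHPMC.perrinRiouHPMCAt_of_thm57` (binder `hsurj`),
* `UniversalToricDescentTwinSplit.twinSplit_instance_of_goodOrd_of_fullImage` (binder `hfull`, done in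
  `…TwinFullThreeAdicImageOverK`),

follows from the census bit (sur) «`ρ̄_{E,p} : Γ_ℚ → GL₂(𝔽_p)` onto» whenever `K` is quadratic with
`p ∤ d_K` (automatic for a Heegner field with `p` split) — at `p ≥ 5` with no further hypothesis, at
`p = 3` for `E` not additive at `3`:

* `isUnit_mem_range_galoisRepTate_baseChange_of_three_le` — `3 ≤ p`, `E/ℚ` minimal, good or
  multiplicative at `p` (used only at `p = 3`), `ρ̄_{E,p}` onto, `K` quadratic, `p ∤ d_K` ⟹
  `Γ_K → Aut_{ℤ_p}(T_pE_K)` onto.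
* `isUnit_mem_range_galoisRepTate_baseChange_of_thm57Hypotheses` — under `YanZhu2026.Thm57Hypotheses`
  (`3 ≤ p` good ordinary, `K` imaginary quadratic with `p` split, …) + (sur).
* `perrinRiouHPMCAt_of_thm57_of_surj` — **Yan–Zhu 2026 Thm. 5.7 (2), integral clause, discharges the
  Perrin-Riou obligation `PerrinRiouHPMCAt` on its locus from (sur) over `ℚ`** (the tree's
  `perrinRiouHPMCAt_of_thm57` with `hsurj` proved), for `K : Type`.
BSD is not proved by any of this.

## References
* [YanZhu2024MainConjNonCM] X. Yan, X. Zhu, J. Algebra 693 (2026), Thm. 5.7 (2) (hypothesis «`ρ_E(G_K) = Aut(T_pE)`»).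
* [Howard2004] B. Howard, Compos. Math. 140 (2004), Thm. B. [SerreAbelianLadic1968] IV-23. [Wuthrich2014] Lemma 20.
-/

noncomputable section

open scoped Classical

set_option linter.dupNamespace false
set_option autoImplicit false

namespace Summit.BirchSwinnertonDyer.BirchSwinnertonDyer.Theorems.AdicImageOverK

open WeierstrassCurve Field NumberField IsDedekindDomain Literature.NumberTheory.EllipticCurves
  Literature.NumberTheory.EllipticCurves.Rank1Residual Literature.NumberTheory.GaloisRepresentations
  Summit.BirchSwinnertonDyer.BirchSwinnertonDyer.Theorems.ThreeAdicImageOverK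
  Summit.BirchSwinnertonDyer.Rank1Residual.PerrinRiouHPMC

/-- **`Γ_K → Aut_{ℤ_p}(T_pE_K)` onto, every odd `p`**: `E/ℚ` minimal, good or multiplicative at `p`
(needed only at `p = 3`), `ρ̄_{E,p}` onto, `K` quadratic with `p ∤ d_K`. (`p = 3`: Wuthrich's
`ℚ`-tower; `p ≥ 5`: Serre's.) [cite: Howard2004, Thm. B (hypothesis)] [cite: Wuthrich2014, Lemma 20 (p. 399)]
[cite: SerreAbelianLadic1968, IV-23 Lemma 3] -/
theorem isUnit_mem_range_galoisRepTate_baseChange_of_three_le (W : WeierstrassCurve ℚ) [W.IsElliptic]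
    [W.IsGloballyMinimal] (K : Type) [Field K] [NumberField K] {p : ℕ} [Fact p.Prime] (h3 : 3 ≤ p)
    (hred : W.HasGoodReductionAtPrime p ∨ W.HasMultiplicativeReductionAtPrime p)
    (h2 : Module.finrank ℚ K = 2) (hd : ¬ (p : ℤ) ∣ NumberField.discr K)
    (hsurj : W.HasSurjectiveModNGaloisRep p) :
    ∀ u : Module.End ℤ_[p] ((W.baseChange K).tateModule p), IsUnit u →
      u ∈ Set.range (galoisRepTate (W.baseChange K) p) := by
  by_cases hp3 : p = 3
  · subst hp3
    exact isUnit_mem_range_galoisRepTate_baseChange_three_of_not_additive W K h2 hd hred hsurj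
  · have h5 : 5 ≤ p := by
      rcases (Fact.out : p.Prime).eq_two_or_odd' with h | ⟨k, hk⟩
      · omega
      · omega
    exact isUnit_mem_range_galoisRepTate_baseChange_of_five_le W K h5 h2 hd hsurj

/-- **Under Yan–Zhu's §5.2 setting** (`YanZhu2026.Thm57Hypotheses`: `3 ≤ p` good ordinary, `K`
imaginary quadratic with `p = 𝔭𝔭̄` split, …) the full-image hypothesis of Thm. 5.7 (2) follows from
(sur) over `ℚ`. [cite: YanZhu2024MainConjNonCM, Thm. 5.7 (2), hypothesis «ρ_E(G_K) = Aut_{ℤ_p}(T_pE)»] -/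
theorem isUnit_mem_range_galoisRepTate_baseChange_of_thm57Hypotheses {N : ℕ} [NeZero N]
    {W : WeierstrassCurve ℚ} [W.IsGloballyMinimal] {K : Type} [Field K] [NumberField K] {p : ℕ}
    [Fact p.Prime] {κ : ZpExtension K p} {γ : absoluteGaloisGroup K}
    (hyp : YanZhu2026.Thm57Hypotheses N W K p κ γ) (hsurj : W.HasSurjectiveModNGaloisRep p) :
    ∀ u : Module.End ℤ_[p] ((W.baseChange K).tateModule p), IsUnit u →
      u ∈ Set.range (galoisRepTate (W.baseChange K) p) := by
  haveI : W.IsElliptic := hyp.isElliptic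
  have hK := hyp.isImaginaryQuadratic
  exact isUnit_mem_range_galoisRepTate_baseChange_of_three_le W K hyp.three_le (Or.inl hyp.goodOrd.1)
    hK.1 (not_dvd_discr_of_ncard_primesOver (K := K) Fact.out (hyp.split.trans hK.1.symm)) hsurj

/-- **Yan–Zhu 2026 Thm. 5.7 (2), integral clause, discharges the Perrin-Riou obligation on its locus
from (sur) over `ℚ`**: the tree's `perrinRiouHPMCAt_of_thm57` with its full-image binder proved.
[cite: YanZhu2024MainConjNonCM, Thm. 5.7 (2), integral clause (arXiv v4 l.1236–1241)] -/
theorem perrinRiouHPMCAt_of_thm57_of_surj {N : ℕ} [NeZero N] {W : WeierstrassCurve ℚ}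
    [W.IsGloballyMinimal] {K : Type} [Field K] [NumberField K] {p : ℕ} [Fact p.Prime]
    {κ : ZpExtension K p} {γ : absoluteGaloisGroup K} {jbar : AlgebraicClosure K →+* ℂ}
    (h : YanZhu2026.thm57_rankOne_charIdealTorsion_eq_heegnerCharIdeal_sq N W K p κ γ jbar)
    (hyp : YanZhu2026.Thm57Hypotheses N W K p κ γ) (hsurj : W.HasSurjectiveModNGaloisRep p) :
    PerrinRiouHPMCAt N W K p κ γ jbar :=
  perrinRiouHPMCAt_of_thm57 h hyp (isUnit_mem_range_galoisRepTate_baseChange_of_thm57Hypotheses hyp hsurj)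

end Summit.BirchSwinnertonDyer.BirchSwinnertonDyer.Theorems.AdicImageOverK

end
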